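import Mathlib
import HarnessLib
import HarnessLib.Audit
import Summits.ValiantsHypothesis.Statement
import Literature.Computability.AlgebraicComplexity.SyntacticMultilinear
import HarnessLib.Audit.Status.Attr

/-!
Route: RyserTripartition

DORMANT since 2026-08-27T16:44:08Z (director-valiant 16:23:56Z (4): negative-value route parked — only RyserOptimal stmt-7159 is load-bearing and stays HELD; stmt-7160 / stmt-11285 HELD as kill switches; reactivate on: a certificate or ) — unstaffed, not closed; items shared with open routes are served there. `ledger route dormant <id> --off` reactivates.

# Route RyserTripartition — Ryser versus Strassen — Ryser-optimality of the permanent is hostage to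
Pratt's tripartition tensor, already at the multilinear rung

It suffices to show X = RYSER-OPTIMALITY (card ryser-vs-strassen-tripartition, typed item
`RyserOptimal`): for every ε > 0 and
all large n, every fan-in-two arithmetic circuit over ℂ computing per_n has at least 2^{(1−ε)n}
gates (Ryser/Glynn give n·2^n). X is
far stronger than VH (X → per ∉ VP_ℂ → VP_ℂ ≠ VNP_ℂ, Valiant completeness); the route exists to make
the EXPONENT question attackable
and killable: the Laplace expansion of per_{3k} along three row blocks is an evaluation of Pratt's
balanced-tripartition trilinear form
T_k (N = C(3k,k) ≈ 6.75^k variables per group) at three tables of k×k sub-permanents computable by a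
syntactically multilinear DP of
size Õ(6.75^k), so smL(per_{3k}) ≤ c·C(T_k) + Õ(6.75^k). Hence X, and already its
syntactically-multilinear rung, FORCES
C(T_k) ≥ 8^{k−o(k)} = N^{1.089−o(1)}: a polynomially super-linear lower bound on the unrestricted
circuit size of an explicit cubic
form; and any C(T_k) ≤ 7.99^k beats Ryser. Under Strassen's asymptotic rank conjecture X further
forces exact signed block designs
to be exponentially dearer than covers (crux ExactDesignsCostly, real from k₀ = 11 on).
Lean: `∀ ε : ℝ, 0 < ε → ∃ n₀ : ℕ, ∀ n ≥ n₀, (2 : ℝ) ^ ((1 - ε) * (n : ℝ)) ≤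
(Literature.Computability.AlgebraicComplexity.complexity
(Literature.Computability.AlgebraicComplexity.perPoly (Fin n) ℂ) : ℝ)`

## Assembly
Pure bookkeeping: `VPNeVNPComplex_iff_perFamily_not_mem_VP` (tree, unconditional) reduces VH to
perFamily ℂ ∉ VP ℂ; membership would
give `IsVPFamily (fun n => perPoly (Fin n) ℂ)` (`mem_VP_ofFintype_iff_holds`), i.e. `complexity
(perPoly (Fin n) ℂ) ≤ n^c + c`
for all n, contradicting RyserOptimal at ε = 1/2 for large n. The cruxes are NOT hypotheses of the
assembly: they are X's unavoidable
explicit shadows (X → MultilinearRyserOptimal → TripartitionHard by RyserToMultilinear + HostageGlue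
+ PerLeTripartition; X ∧ ARC →
ExactDesignsCostly informally), staffed bottom-up because each is cheaper to kill and any proof of X
contains theirs.

Rationale: WHY THIS LINE. Mechanism (card ryser-vs-strassen-tripartition): per(M) = T_k[f,g,h] with f_S = per
M[R₁,S], g_T = per M[R₂,T], h_U = per M[R₃,U]
(3-block Laplace expansion), T_k = Σ_{S⊔T⊔U=[3k]} X_S Y_T Z_U Pratt's tensor (arXiv:2311.02774 Def
1.4; C(T_k) ≤ Õ(8^k) by
Z₂^{3k}-Fourier, R(T_k) ≤ 8^k/2, SCC ⇒ AR(T_k) > (8−ε)^k, Cor 1.11–1.12), the exactly-balanced layer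
of the Björklund–Kaski
three-way partitioning tensor (arXiv:2310.11926). New here versus the card: the whole bridge is
syntactically multilinear and
degree-3 homogenisation costs O(1), so even MULTILINEAR Ryser-optimality (a model with its own
lower-bound technology: Raz,
Raz–Yehudayoff, Raz–Shpilka–Yehudayoff doi:10.1137/070707932, Alon–Kumar–Volk arXiv:1708.02037)
already implies the general-circuit
bound C(T_k) ≥ 8^{k−o(k)} — the first waypoint of ANY proof on this line is an explicit super-linear
trilinear lower bound
(TripartitionHard, rank 2), beyond Baur–Strassen's Ω(N log d) and the 8N rank-method ceiling (EGOW
arXiv:1710.09502). Imported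
areas: fine-grained complexity (SCC arXiv:1112.2275, #ETH permanent arXiv:1206.1775), asymptotic
spectra / ARC (Strassen 1994,
CGLVW arXiv:1811.05511, tree `asymptoticRank`), and combinatorial design theory (signed/exact
designs, KLP arXiv:1302.4295) for
ExactDesignsCostly, whose threshold 8^{k₀}/C(3k₀,k₀) crosses the covering bound exactly at Pratt's k
= 11. Prior routes of this
summit (dc-rigidity, GCT, τ, depth-4, immanants, monotone/division) never touch the exponent;
negatives index empty; arXiv:2601.00387
(2026) asks the 2^{o(n)} question for exponential sums under τ — the coarse (ETH-type) regime, not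
the base-2 (SETH-type) one here.

RANKED CRUXES. #0 RyserOptimal (target) — X: for every ε > 0 there is n₀ with 2^{(1−ε)n} ≤ L(per_n)
(fan-in-two `complexity` over ℂ) for all n ≥ n₀ (card items RyserOptimal / SubRyser = its negation).
(why it might fail: far stronger than VH and false in char 2 (per = det); any C(T_k) ≤ 7.99^k for
large k refutes it via PerLeTripartition; Björklund's Boolean 2^{n−Ω(√(n/log n))} (arXiv:1211.0391)
shows the 2^n wall is soft at lower order.) [arXiv:2311.02774, arXiv:1206.1775, arXiv:1211.0391,
arXiv:2601.00387, Burgisser2000]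
#2 TripartitionHard (crux) — Pratt's balanced-tripartition form T_k (variables X_(i,S), i ∈ Fin 3, S
a k-subset of Fin 3k; monomials X_(0,S)X_(1,T)X_(2,U) over pairwise disjoint S,T,U) needs fan-in-two
circuits over ℂ of size ≥ 8^{(1−ε)k} for all large k, every ε > 0 (card C2); = N^{1.089−o(1)}, N =
C(3k,k). Necessary for X and for MultilinearRyserOptimal (HostageGlue). [difficulty: open-problem]
(why it might fail: a (8−δ)^k evaluation of T_k (cleverer exact-cover algebra than Z₂^{3k}-Fourier:
cheap exact block designs × low Kronecker-power rank, or a direct bilinear algorithm; R(T_k) ≤ 8^k/2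
already) refutes it and beats Ryser; proving it is an explicit super-linear bound no known technique
gives.) [arXiv:2311.02774, arXiv:2310.11926, arXiv:2404.04987, arXiv:1710.09502,
doi:10.1016/0304-3975(83)90110-X]
#3 MultilinearRyserOptimal (crux) — Ryser is optimal among syntactically multilinear circuits: for
every ε > 0 and all large n, every fan-in-two syntactically multilinear circuit over ℂ computing
per_n has ≥ 2^{(1−ε)n} gates (Ryser's formula and the column-subset DP are such circuits, of size
~n·2^n). Necessary for X (RyserToMultilinear); by HostageGlue it already implies TripartitionHard
for GENERAL circuits. [deps: TripartitionHard] [difficulty: open-problem] (why it might fail: one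
(2−δ)^n syntactically multilinear circuit for per_n kills it — PerLeTripartition turns any (8−δ)^k
circuit for T_k into one; and proving it cannot be easier than TripartitionHard (HostageGlue), far
above the n³ ceiling of Raz's full-rank method (FullRankMultilinear) and RSY's n^{4/3}.)
[doi:10.1137/070707932, arXiv:1708.02037, RazYehudayoff2008, arXiv:2311.02774,
doi:10.1007/BF01294256]
#4 ExactDesignsCostly (crux) — (card C4, made quantitative) for every block size k₀ ≥ 1, every ε > 0
and all large m (ground set Fin (3k₀m)): every real-weighted family w of set partitions π of the
ground set that is an EXACT signed block design — Σ_π w_π·[every part of π contains exactly k₀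
points of each colour] = 1 for every balanced 3-colouring (colour classes of size k₀m) — has support
of size ≥ (8^{k₀}/C(3k₀,k₀))^{(1−ε)m}. Trivial for k₀ ≤ 10 (covering bound
27^{k₀}/(C(3k₀,k₀)C(2k₀,k₀)) per block is larger); real from k₀ = 11 on (Pratt's "k = 11" remark);
necessary for X under ARC (informal glue: C(T_k) ≤ |supp w|·C(T_{k₀}^{⊠m}) ≤ |supp
w|·(C(3k₀,k₀)+ε)^m). [deps: TripartitionHard] [difficulty: L] (why it might fail: signed/exact
designs are typically as small as linear algebra allows (Graver–Jurkat, Wilson, KLP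
arXiv:1302.4295); an exact design within (44.4/40.7)^m of the covering bound at k₀ = 11 (or
(54.9/44.3)^m at k₀ = 12) refutes it and gives ARC ⇒ ¬RyserOptimal.) [arXiv:2311.02774,
arXiv:2310.11926, arXiv:1302.4295, arXiv:2404.04987]
#9 PerLeTripartition (support) — the bridge (card C3): there is c such that for every k and every
fan-in-two circuit Γ computing T_k there is a fan-in-two SYNTACTICALLY MULTILINEAR circuit computing
per_{3k} of size ≤ c·|Γ| + c(k+1)^c·C(3k,k) (homogenise Γ to {0,1}³-multidegree components, O(1)
blow-up; feed the three row-block DP tables p_{j+1}(S∪{col}) = Σ p_j(S)·x_{row,col}, ≤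
7(k+1)²C(3k,k) gates; Laplace expansion along the row blocks {0..k−1},{k..2k−1},{2k..3k−1}).
[difficulty: M] [arXiv:2311.02774, Burgisser2000, RazYehudayoff2008]
#9 HostageGlue (support) — PerLeTripartition → MultilinearRyserOptimal → TripartitionHard (pure
asymptotics: `complexity` is attained by some fan-in-two Γ (Nat.sInf_mem,
ArithCircuit.exists_computes); C(3k,k)·k^k·(2k)^{2k} ≤ (3k)^{3k} gives C(3k,k) ≤ (27/4)^k <
8^{(1−ε)k}/(2c(k+1)^c) once ε < 0.08 and k is large; monotonicity in ε does the rest). [difficulty: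
provable-now] [arXiv:2311.02774]
#9 RyserToMultilinear (support) — RyserOptimal → MultilinearRyserOptimal (a syntactically
multilinear fan-in-two circuit is a fan-in-two circuit: `complexity ≤ P.size` by Nat.sInf_le).
[difficulty: provable-now] [Burgisser2000]

TWO-LAYER PLAN. TripartitionHard ⇐ TripartitionRankHard (tensorRank of the 0/1 tensor of T_k ≥
8^{(1−ε)k}; SCC ⇒ it, Pratt Cor 1.12) → RankToCircuit
(R(T) ≤ c·L(T): Baur–Strassen doi:10.1016/0304-3975(83)90110-X + Strassen 1973) → TripartitionHard;
below that the honest first rungs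
R(T_k) ≥ 3N − o(N) (substitution method) and border rank ≥ (1+ε)N (super-flattening, cf.
Landsberg–Michałek arXiv:1912.11927).
ExactDesignsCostly ⇐ (k₀ ≤ 10 by the covering count, provable now) → (k₀ ≥ 11: an LP-dual witness
family in the association scheme
of balanced colourings) → ExactDesignsCostly. MultilinearRyserOptimal: no split before
TripartitionHard moves (HostageGlue).

KILL CRITERIA. ¬TripartitionHard witnessed by a (8−δ)^k circuit family for T_k (all large k) ⇒ by
PerLeTripartition + HostageGlue both
MultilinearRyserOptimal and RyserOptimal are refuted: close `refuted:TripartitionHard` and file the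
sub-Ryser permanent circuit as the
headline negative (it also retypes what anti-cramer/KRST-style cards assume). A direct (2−δ)^n
syntactically multilinear circuit for
per_n ⇒ close `refuted:MultilinearRyserOptimal`. ¬ExactDesignsCostly at one k₀ ≥ 11 is NOT a kill:
it yields the conditional theorem
ARC ⇒ ¬RyserOptimal (new: BCHKP arXiv:2404.04987 §5 leave exact counting under ARC open) — pivot the
route to that negative thesis
(restate X := ¬RyserOptimal under `strassen`-ARC as a conditional bridge) rather than close. per ∉
VP proved elsewhere moots the
assembly but not the calibration items.

NOT DECOMPOSED YET. The ARC-conditional glue X ∧ ARC → ExactDesignsCostly (needs ARC as a Literature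
fact over the tree's `asymptoticRank`, the
Kronecker-power evaluation lemma "AR(T) ≤ x ⇒ C(T^{⊠m}) ≤ (x+ε)^m·poly" and the design reduction
C(T_k) ≤ |supp w|·(C(T_{k₀}^{⊠m})+1));
designs with unbalanced local types (a,b,c) ≠ (k₀,k₀,k₀) (more flexible, so a TRUE
ExactDesignsCostly does not yet exhaust "ARC cannot
beat Ryser this way"); border-rank and asymptotic-rank rungs for T_k (no generic `borderRank` in the
tree); the restricted models where
Ryser-optimality IS a theorem (nc-ABP width 2^n, Nisan doi:10.1145/103418.103462; Waring rank of
x₁⋯x_n = 2^{n−1}, arXiv:1104.3648;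
monotone n(2^{n−1}−1), JerrumSnir1982; set-multilinear ΣΠΣ ≥ C(n,n/2), doi:10.1007/BF01294256) —
context for refuters, not items;
constants c in PerLeTripartition (any c works for HostageGlue).

CHEAPEST FALSIFIER. A lookup refuters should run first: is an O((8−δ)^k) = O(2^{(1−δ')n}) algebraic
algorithm for WEIGHTED balanced 3-way partition
counting (evaluating T_k at arbitrary tables; equivalently the middle-layer (S,T,U)-convolution)
already in the exact-algorithms
literature (Björklund–Husfeldt–Koivisto subset convolution / set-partition counting is 2^n·poly =
8^k·poly, i.e. exactly the trivial
bound; Björklund arXiv:1107.4466, arXiv:1211.0391 go below 2^n only Booleanly)? By PerLeTripartition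
any such algorithm is a sub-Ryser
permanent circuit, so the sixty-year record (arXiv:2601.00387 p.3: "Ryser's formula … has not been
improved since") says no — if one
exists the route dies at once and the hub gains a theorem. Second cheapest: kit LP for the
exact-design support at k₀ = 11, m = 2
(orbit-reduced under S_33 × S_33) against the bound 44.4² — feasibility of a near-cover-size signed
design there is the first datum on
ExactDesignsCostly. I could run neither here (lit APIs rate-limited, no kit in plancard mode).

NUMBERS. N = C(3k,k) ≤ (27/4)^k (from C(3k,k)k^k(2k)^{2k} ≤ (3k)^{3k}); 8^k = N^{log 8/log 6.75} =
N^{1.08897}. Known for T_k (arXiv:2311.02774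
pp. 3–5): C(T_k) ≤ 8^k·poly(k) (Z₂^{3k} Fourier), R(T_k) ≤ 8^k/2 (char ≠ 2; T_1 = the per_3 tensor),
flattening R(T_k) ≥ N; SCC ⇒ AR(T_k) > (8−ε)^k
and R(T_k) ≥ (2/9)8^k/k; ARC ⇒ AR(T_k) ≤ N. Rank-method ceiling for N×N×N tensors: 8N
(arXiv:1710.09502); best explicit rank ≥ 3N−o(N),
border rank ≥ 2.02N (arXiv:1912.11927); best explicit total-circuit lower bound for constant-degree
forms: linear. Permanent: Ryser
O(n·2^n) gates, Glynn 2^{n−1} products; smcircuit DP n·2^{n−1}; multilinear lower bounds known: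
formulas n^{Ω(log n)} (Raz), circuits
Ω(n^{4/3}/log²) (RSY doi:10.1137/070707932), Ω(n²/log² n) for an explicit f (AKV arXiv:1708.02037),
method ceiling n³ (FullRankMultilinear).
ExactDesignsCostly thresholds per block, b(k₀) = 8^{k₀}/C(3k₀,k₀) versus covering bound L(k₀) =
27^{k₀}/(C(3k₀,k₀)C(2k₀,k₀)):
k₀=10: 35.7 vs 37.1 (trivial); k₀=11: 44.4 vs 40.7; k₀=12: 54.9 vs 44.3; k₀=15: 102 vs 55.2; k₀=30:
1839 vs 110; b > L iff
C(2k₀,k₀) > (27/8)^{k₀} iff k₀ ≥ 11 (= Pratt's "k = 11 is the smallest value" remark, p. 4).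
ARC-runtime base C(3k₀,k₀)^{1/k₀}·L^{1/k₀}:
8.03 (k₀=10), 7.94 (11), 7.86 (12), 7.28 (30) → 6.75. Items at open: 8 (1 target, 3 cruxes, 3
support, 1 assembly).

DEFINITION REQUESTS. None filed. T_k is inlined (three occurrences) over `MvPolynomial (Fin 3 × {A :
Finset (Fin (3k)) // A.card = k}) ℂ`; `complexity`,
`perPoly`, `ArithCircuit.{IsFanInTwo,Computes,size}` (ArithCircuit.lean, StandardFamilies.lean) and
`IsSyntacticallyMultilinear`
(Barriers/ValiantsHypothesis/FullRankMultilinear.lean) exist; `tensorRank`, `asymptoticRank`,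
`kroneckerPow` (AsymptoticSpectrum.lean)
are ready for the layer-2 rank rungs. Nice-to-have later (not filed):
`Literature.Computability.AlgebraicComplexity.Pratt.tripartitionPoly k`
/ `tripartitionTensor k` (arXiv:2311.02774 Def 1.4) with the facts R ≤ 8^k/2, R ≥ C(3k,k), Cor
1.11–1.12, and Strassen's ARC as a named Prop.

Novelty: Searches (2026-08-15): `lit search --source local --no-graph "Ryser formula permanent optimal lower
bound"` (8: arXiv:1206.1775 #ETH-permanent,
arXiv:2601.00387 exp-sums-under-τ, arXiv:1807.06194 Waring/Gurvits "Ryser essentially optimal" in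
the Waring model, arXiv:1401.0189,
arXiv:2406.06217, arXiv:1508.05788); `lit search --source local --no-graph "syntactically
multilinear circuit permanent lower bound"` (8: RSY
doi:10.1137/070707932, AKV arXiv:1708.02037, Raz–Yehudayoff CCC 2008, Jansen 2008, HWY 2010); `lit
galaxy search "asymptotic rank conjecture"
--star all` (2: CGLVW geometric ARC, Landsberg–Michałek 2.02m); `lit galaxy search "signed designs"
--star all` (24 rows, all noise);
`lit galaxy search "permanent faster than Ryser" --star all` (0); `lit search --source zbmath
"permanent Ryser formula complexity"` (1: Fomin–Kratsch
book); `lit read arxiv:2311.02774` pp. 2–5 (Def 1.4, Thm 1.9, Cor 1.10–1.12, 8^k/2, k = 11) and `lit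
read arxiv:2601.00387` pp. 2–6; arXiv /
OpenAlex / S2 HTTP 429 and searchd exit 75 at filing (recorded, not worked around); plus the card's
own searches (arXiv ARC list 2311.02774,
2310.11926, 2404.04987, 2404.06427, 2411.15789, 2601.08119; grep permanent/counting = 0 in BK and
Pratt; BCHKP §5 "we do not know how to count
colorings … under the asymptotic rank conjecture").
Nearest prior art found: Pratt arXiv:2311.02774 = doi:10.1145/3618260.3649620 (T_k, rank bounds, SCC
⇔ ARC tension, decision only);
Björklund–Kaski arXiv:2310.11926 and BCHKP arX  [refs: 10.1137/070707932, 10.1145/3618260.3649620, 1206.1775, 2601.00387, 1807.06194, 1401.0189, 2406.06217, 1508.05788, 1708.02037, 2311.02774, 2310.11926, 2404.04987, doi:10.1137/070707932, arxiv:2311.02774, arxiv:2601.00387, doi:10.1145/3618260.3649620]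

Barriers (technique_class: fine-grained, tensor-rank, signed-designs, multilinear): - technique_class: fine-grained, tensor-rank, signed-designs, multilinear
- Literature.Barriers.ValiantsHypothesis.RankMethods: bites on TripartitionHard/its rank child
exactly — flattening-type measures certify ≤ 8N ≪ N^{1.089} for any N×N×N tensor; the route USES
this (Ryser-optimality is unprovable-in-kind today) and sends layer 2 to substitution /
border-apolarity arguments outside the rank-method class; it does not pretend to evade it.
- Literature.Barriers.ValiantsHypothesis.RankLifting: same scope (lifting rank bounds to T_k's
degree 3 is vacuous; no escalation is proposed); conceded.
- Literature.Barriers.ValiantsHypothesis.FullRankMultilinear: MultilinearRyserOptimal asks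
2^{(1−ε)n} where Raz's full-rank method stops at n³ for smcircuits; it does not evade — the bet
(HostageGlue) is the opposite: the multilinear rung is provably NOT easier than the general
trilinear bound, so effort goes to TripartitionHard, and refuters get a cheap multilinear kill
target.
- Literature.Barriers.ValiantsHypothesis.NoncommutativeExtensions: TripartitionHard is a
super-linear-in-dn bound (d = 3, 3N variables) for an explicit form, so any proof must fail over
some noncommutative extension ring (not extension-robust); acknowledged constraint on layer-2
techniques, no evasion claimed.
- Literature.Barriers.ValiantsHypothesis.MonotoneGap: Jerrum–Snir's exact monotone n(2^{n−1}−1) is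
the monotone shadow of X and is NOT used as evidence; the bridge circuits use cancellations only
inside Γ (T

Novelty grade: new-combination — refuter route-review rreview-70aad721: new-combination = (Pratt's balanced-tripartition tensor T_k and its ARC/SCC tension, 2311.02774 Def 1.4/Cor 1.11–1.12, read pp.3–5) + (3-block Laplace expansion of per_{3k} as a syntactically multilinear evaluation of T_k, folklore/CW's T_1 = per_3) joined into (refuter refuter-rreview-route-SmoothPoincare4-Re-70aad721-0, 2026-08-15T14:07:51Z; prior: arxiv:2311.02774, arxiv:2310.11926, arxiv:2404.04987, arxiv:1206.1775, doi:10.1137/070707932, arxiv:1708.02037)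

History (route lifecycle, newest last):
- 2026-08-15T17:00:19Z · rev 2: restated MultilinearRyserOptimal (stmt-ValiantsHypothesis-7161), PerLeTripartition (stmt-ValiantsHypothesis-7163) — cone repair (rrepair g2): restate MultilinearRyserOptimal + PerLeTripartition over the fact-free Literature.Computability.AlgebraicComplexity.IsSyntacticallyMul (planner-rrepair-ValiantsHypothesis-RyserTripar-43303922-g2-0)
- 2026-08-16T04:21:55Z · AUTO-CRUX (backfill): RyserOptimal — hypotheses of the deciding theorem that nothing in the route derives are cruxes (operator:999:1085951)
- 2026-08-22T12:57:27Z · DORMANT — reconciler: no traction for 5.3 d (last activity item-evidence-added at 2026-08-17T04:04:15Z); parked, not closed — `ledger route dormant route-ValiantsHypothes (operator:999:3198178)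
- 2026-08-26T06:37:20Z · REACTIVATED — reconciler: reactivated — activity statement-closed at 2026-08-26T05:42:23Z after parking at 2026-08-22T12:57:27Z (operator:999:670464)
- 2026-08-27T16:44:08Z · DORMANT — director-valiant 16:23:56Z (4): negative-value route parked — only RyserOptimal stmt-7159 is load-bearing and stays HELD; stmt-7160 / stmt-11285 HELD as kill sw (operator:999:3279581)

sub-problem: ValiantsHypothesis · status: dormant · opened planner-plancard-ValiantsHypothesis-ValiantsH-e19a6dd4-0 2026-08-15T12:04:31Z · rev 2 · ledger route-ValiantsHypothesis-RyserTripartition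
GENERATED by the gate from the ledger (D-0016/17). Provers cite these decls: `theorem foo : Summit.ValiantsHypothesis.ValiantsHypothesis.Theses.RyserTripartition.<Decl> := …` in Summits/ValiantsHypothesis/ValiantsHypothesis/Theorems/<Name>.lean.
-/

namespace Summit.ValiantsHypothesis.ValiantsHypothesis.Theses.RyserTripartition

open scoped BigOperators Topology Manifold Classical MeasureTheory ProbabilityTheory Matrix InnerProductSpace ComplexConjugate ContinuousMap
open Filter Set Function TopologicalSpace MeasureTheory

attribute [summit_statement] _root_.ValiantsHypothesis

open Literature.PNP

/-- item stmt-ValiantsHypothesis-7159 · crux (kind.auto-crux: conjecture-grade) · rank 0 · open · by planner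
why it might fail: far stronger than VH and false in char 2 (per = det); any C(T_k) ≤ 7.99^k for large k refutes it via PerLeTripartition; Björklund's Boolean 2^{n−Ω(√(n/log n))} (arXiv:1211.0391) shows the 2^n wall is soft at lower order.
sources: arXiv:2311.02774, arXiv:1206.1775, arXiv:1211.0391, arXiv:2601.00387, Burgisser2000
[target] X: for every ε > 0 there is n₀ with 2^{(1−ε)n} ≤ L(per_n) (fan-in-two `complexity` over ℂ)
for all n ≥ n₀ (card items RyserOptimal / SubRyser = its negation). -/
@[route_item "route-ValiantsHypothesis-RyserTripartition", crux]
def RyserOptimal : Prop :=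
  ∀ ε : ℝ, 0 < ε → ∃ n₀ : ℕ, ∀ n ≥ n₀, (2 : ℝ) ^ ((1 - ε) * (n : ℝ)) ≤ (Literature.Computability.AlgebraicComplexity.complexity (Literature.Computability.AlgebraicComplexity.perPoly (Fin n) ℂ) : ℝ)

/-- item stmt-ValiantsHypothesis-7160 · crux · rank 2 · open · by planner
why it might fail: a (8−δ)^k evaluation of T_k (cleverer exact-cover algebra than Z₂^{3k}-Fourier: cheap exact block designs × low Kronecker-power rank, or a direct bilinear algorithm; R(T_k) ≤ 8^k/2 already) refutes it and beats Ryser; proving it is an explicit super-linear bound no known technique gives.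
sources: arXiv:2311.02774, arXiv:2310.11926, arXiv:2404.04987, arXiv:1710.09502, doi:10.1016/0304-3975(83)90110-X
[crux] Pratt's balanced-tripartition form T_k (variables X_(i,S), i ∈ Fin 3, S a k-subset of Fin 3k;
monomials X_(0,S)X_(1,T)X_(2,U) over pairwise disjoint S,T,U) needs fan-in-two circuits over ℂ of
size ≥ 8^{(1−ε)k} for all large k, every ε > 0 (card C2); = N^{1.089−o(1)}, N = C(3k,k). Necessary
for X and for MultilinearRyserOptimal (HostageGlue). [difficulty: open-problem] -/
@[route_item "route-ValiantsHypothesis-RyserTripartition", crux]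
def TripartitionHard : Prop :=
  ∀ ε : ℝ, 0 < ε → ∃ k₀ : ℕ, ∀ k ≥ k₀, (8 : ℝ) ^ ((1 - ε) * (k : ℝ)) ≤ (Literature.Computability.AlgebraicComplexity.complexity (∑ S : {A : Finset (Fin (3 * k)) // A.card = k}, ∑ T : {A : Finset (Fin (3 * k)) // A.card = k}, ∑ U : {A : Finset (Fin (3 * k)) // A.card = k}, if Disjoint S.1 T.1 ∧ Disjoint S.1 U.1 ∧ Disjoint T.1 U.1 then (MvPolynomial.X (0, S) * MvPolynomial.X (1, T) * MvPolynomial.X (2, U) : MvPolynomial (Fin 3 × {A : Finset (Fin (3 * k)) // A.card = k}) ℂ) else 0) : ℝ)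

-- earlier MultilinearRyserOptimal (stmt-ValiantsHypothesis-7161, replaced 2026-08-15T17:00:19Z -> stmt-ValiantsHypothesis-11285): retired by None — ∀ ε : ℝ, 0 < ε → ∃ n₀ : ℕ, ∀ n ≥ n₀, ∀ P : Literature.Computability.AlgebraicComplexity.ArithCircuit ℂ (Fin n × Fin n), P.IsFanInTwo → Literature.Barriers.ValiantsHypothesis.IsSyntacticallyMultilinear P → P.Computes (Literature.Computability.AlgebraicCom
/-- item stmt-ValiantsHypothesis-11285 · crux · rank 3 · open · by planner
why it might fail: one (2−δ)^n syntactically multilinear circuit for per_n kills it — PerLeTripartition turns any (8−δ)^k circuit for T_k into one; and proving it cannot be easier than TripartitionHard (HostageGlue), far above the n³ ceiling of Raz's full-rank method (FullRankMultilinear) and RSY's n^{4/3}.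
sources: doi:10.1137/070707932, arXiv:1708.02037, RazYehudayoff2008, arXiv:2311.02774, doi:10.1007/BF01294256
[crux] Ryser is optimal among syntactically multilinear circuits: for every ε > 0 and all large n,
every fan-in-two syntactically multilinear circuit over ℂ computing per_n has ≥ 2^{(1−ε)n} gates
(Ryser's formula and the column-subset DP are such circuits, of size ~n·2^n). Necessary for X
(RyserToMultilinear); by HostageGlue it already implies TripartitionHard for GENERAL circuits.
Restated 2026-08-15 (cone repair, meaning unchanged): `IsSyntacticallyMultilinear` is now the
fact-free `Literature.Computability.AlgebraicComplexity.IsSyntacticallyMultilinear`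
(SyntacticMultilinear.lean; equivalent to the former barrier-file copy by
`Literature.Barriers.ValiantsHypothesis.isSyntacticallyMultilinear_iff_algebraicComplexity`), and
the three admissibility hypotheses are bundled as `P.IsFanInTwo ∧ IsSyntacticallyMultilinear P ∧
P.Computes per_n` — literally the index predicate of `smCircuitSize`, so `smCircuitSize_le` applies
verbatim; equivalent to the curried form (checked in the planner's Sketch). Earlier verdicts on
stmt-ValiantsHypothesis-7161 (refuter: elaborates, non-vacuous via Ryser/column-subset DP, open both
ways; grounder: new/open) carry over. [deps: TripartitionHard] [difficu -/
@[route_item "route-ValiantsHypothesis-RyserTripartition", crux]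
def MultilinearRyserOptimal : Prop :=
  ∀ ε : ℝ, 0 < ε → ∃ n₀ : ℕ, ∀ n ≥ n₀, ∀ P : Literature.Computability.AlgebraicComplexity.ArithCircuit ℂ (Fin n × Fin n), P.IsFanInTwo ∧ Literature.Computability.AlgebraicComplexity.IsSyntacticallyMultilinear P ∧ P.Computes (Literature.Computability.AlgebraicComplexity.perPoly (Fin n) ℂ) → (2 : ℝ) ^ ((1 - ε) * (n : ℝ)) ≤ (P.size : ℝ)

/-- item stmt-ValiantsHypothesis-7162 · crux · rank 4 · open · by planner
why it might fail: signed/exact designs are typically as small as linear algebra allows (Graver–Jurkat, Wilson, KLP arXiv:1302.4295); an exact design within (44.4/40.7)^m of the covering bound at k₀ = 11 (or (54.9/44.3)^m at k₀ = 12) refutes it and gives ARC ⇒ ¬RyserOptimal.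
sources: arXiv:2311.02774, arXiv:2310.11926, arXiv:1302.4295, arXiv:2404.04987
[crux] (card C4, made quantitative) for every block size k₀ ≥ 1, every ε > 0 and all large m (ground
set Fin (3k₀m)): every real-weighted family w of set partitions π of the ground set that is an EXACT
signed block design — Σ_π w_π·[every part of π contains exactly k₀ points of each colour] = 1 for
every balanced 3-colouring (colour classes of size k₀m) — has support of size ≥
(8^{k₀}/C(3k₀,k₀))^{(1−ε)m}. Trivial for k₀ ≤ 10 (covering bound 27^{k₀}/(C(3k₀,k₀)C(2k₀,k₀)) per
block is larger); real from k₀ = 11 on (Pratt's "k = 11" remark); necessary for X under ARC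
(informal glue: C(T_k) ≤ |supp w|·C(T_{k₀}^{⊠m}) ≤ |supp w|·(C(3k₀,k₀)+ε)^m). [deps:
TripartitionHard] [difficulty: L] -/
@[route_item "route-ValiantsHypothesis-RyserTripartition", crux]
def ExactDesignsCostly : Prop :=
  ∀ k₀ : ℕ, 0 < k₀ → ∀ ε : ℝ, 0 < ε → ∃ m₀ : ℕ, ∀ m ≥ m₀, ∀ w : Finpartition (Finset.univ : Finset (Fin (3 * k₀ * m))) → ℝ, (∀ c : Fin (3 * k₀ * m) → Fin 3, (∀ i : Fin 3, (Finset.univ.filter fun x => c x = i).card = k₀ * m) → ∑ π, w π * (if ∀ p ∈ π.parts, ∀ i : Fin 3, (p.filter fun x => c x = i).card = k₀ then (1 : ℝ) else 0) = 1) → ((8 : ℝ) ^ k₀ / (Nat.choose (3 * k₀) k₀ : ℝ)) ^ ((1 - ε) * (m : ℝ)) ≤ ((Finset.univ.filter fun π => w π ≠ 0).card : ℝ)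

-- earlier PerLeTripartition (stmt-ValiantsHypothesis-7163, replaced 2026-08-15T17:00:19Z -> stmt-ValiantsHypothesis-11286): retired by None — ∃ c : ℕ, ∀ k : ℕ, ∀ Γ : Literature.Computability.AlgebraicComplexity.ArithCircuit ℂ (Fin 3 × {A : Finset (Fin (3 * k)) // A.card = k}), Γ.IsFanInTwo → Γ.Computes (∑ S : {A : Finset (Fin (3 * k)) // A.card = k}, ∑ T : {A : Finset (Fin (3 * k)) // A.card = k}, ∑
/-- item stmt-ValiantsHypothesis-11286 · support · rank 9 · closed · proved by Summit.ValiantsHypothesis.ValiantsHypothesis.Theorems.RyserTripartition.perLeTripartition_proof (prover) · by planner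
sources: arXiv:2311.02774, Burgisser2000, RazYehudayoff2008
[support] the bridge (card C3): there is c such that for every k and every fan-in-two circuit Γ
computing T_k there is a fan-in-two SYNTACTICALLY MULTILINEAR circuit computing per_{3k} of size ≤
c·|Γ| + c(k+1)^c·C(3k,k) (homogenise Γ into its components of {0,1}³-multidegree w.r.t. the three
variable groups, O(1) blow-up — the components of multidegree ≤ (1,1,1) of a product depend only on
such components of the factors, and every surviving product multiplies children with disjoint group
supports or a variable-free child, so the result is syntactically multilinear; substitute for
X_(i,S) the row-block DP tables p_{j+1}(S∪{col}) = Σ p_j(S)·x_{row_{j+1},col} (≤ 7(k+1)²C(3k,k)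
gates, every product joins distinct rows); Laplace expansion of per_{3k} along the row blocks
{0..k−1},{k..2k−1},{2k..3k−1}). Restated 2026-08-15 (cone repair, meaning unchanged):
`IsSyntacticallyMultilinear` is now the fact-free
`Literature.Computability.AlgebraicComplexity.IsSyntacticallyMultilinear`
(SyntacticMultilinear.lean; the barrier namespace's circuit lemmas, e.g.
FullRankMultilinearCircuit.lean, transfer by `isSyntacticallyMultilinear_iff_algebraicComplexity`),
and the hypotheses on Γ are bundled as ` -/
@[route_item "route-ValiantsHypothesis-RyserTripartition", crux]
def PerLeTripartition : Prop :=
  ∃ c : ℕ, ∀ k : ℕ, ∀ Γ : Literature.Computability.AlgebraicComplexity.ArithCircuit ℂ (Fin 3 × {A : Finset (Fin (3 * k)) // A.card = k}), Γ.IsFanInTwo ∧ Γ.Computes (∑ S : {A : Finset (Fin (3 * k)) // A.card = k}, ∑ T : {A : Finset (Fin (3 * k)) // A.card = k}, ∑ U : {A : Finset (Fin (3 * k)) // A.card = k}, if Disjoint S.1 T.1 ∧ Disjoint S.1 U.1 ∧ Disjoint T.1 U.1 then (MvPolynomial.X (0, S) * MvPolynomial.X (1, T) * MvPolynomial.X (2,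 U) : MvPolynomial (Fin 3 × {A : Finset (Fin (3 * k)) // A.card = k}) ℂ) else 0) → ∃ P : Literature.Computability.AlgebraicComplexity.ArithCircuit ℂ (Fin (3 * k) × Fin (3 * k)), P.IsFanInTwo ∧ Literature.Computability.AlgebraicComplexity.IsSyntacticallyMultilinear P ∧ P.Computes (Literature.Computability.AlgebraicComplexity.perPoly (Fin (3 * k)) ℂ) ∧ P.size ≤ c * Γ.size + c * (k + 1) ^ c * Nat.choose (3 * k) k

-- `PerLeTripartition` holds: proved by `Summit.ValiantsHypothesis.ValiantsHypothesis.Theorems.RyserTripartition.perLeTripartition_proof` (its module imports this route file, so no `_holds` link can be stated here).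

/-- item stmt-ValiantsHypothesis-7164 · support · rank 9 · closed · proved by Summit.ValiantsHypothesis.ValiantsHypothesis.Theorems.RyserTripartition.hostageGlue_proof (prover) · by planner
sources: arXiv:2311.02774
[support] PerLeTripartition → MultilinearRyserOptimal → TripartitionHard (pure asymptotics:
`complexity` is attained by some fan-in-two Γ (Nat.sInf_mem, ArithCircuit.exists_computes);
C(3k,k)·k^k·(2k)^{2k} ≤ (3k)^{3k} gives C(3k,k) ≤ (27/4)^k < 8^{(1−ε)k}/(2c(k+1)^c) once ε < 0.08
and k is large; monotonicity in ε does the rest). [difficulty: provable-now] -/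
@[route_item "route-ValiantsHypothesis-RyserTripartition", crux]
def HostageGlue : Prop :=
  PerLeTripartition → MultilinearRyserOptimal → TripartitionHard

-- `HostageGlue` holds: proved by `Summit.ValiantsHypothesis.ValiantsHypothesis.Theorems.RyserTripartition.hostageGlue_proof` (its module imports this route file, so no `_holds` link can be stated here).

/-- item stmt-ValiantsHypothesis-7165 · support · rank 9 · closed · proved by Summit.ValiantsHypothesis.ValiantsHypothesis.Theorems.RyserTripartition.ryserToMultilinear_proof (prover) · by planner
sources: Burgisser2000
[support] RyserOptimal → MultilinearRyserOptimal (a syntactically multilinear fan-in-two circuit is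
a fan-in-two circuit: `complexity ≤ P.size` by Nat.sInf_le). [difficulty: provable-now] -/
@[route_item "route-ValiantsHypothesis-RyserTripartition", crux]
def RyserToMultilinear : Prop :=
  RyserOptimal → MultilinearRyserOptimal

-- `RyserToMultilinear` holds: proved by `Summit.ValiantsHypothesis.ValiantsHypothesis.Theorems.RyserTripartition.ryserToMultilinear_proof` (its module imports this route file, so no `_holds` link can be stated here).

/-- item stmt-ValiantsHypothesis-7166 · assembly · rank 1 · closed · proved by Summit.ValiantsHypothesis.ValiantsHypothesis.Theorems.RyserTripartition.assembly_proof (prover) · by planner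
sources: Valiant1979, Burgisser2000
[assembly] RyserOptimal → ValiantsHypothesis (VP_ℂ ≠ VNP_ℂ). -/
@[route_item "route-ValiantsHypothesis-RyserTripartition", crux]
def Assembly : Prop :=
  RyserOptimal → ValiantsHypothesis

-- `Assembly` holds: proved by `Summit.ValiantsHypothesis.ValiantsHypothesis.Theorems.RyserTripartition.assembly_proof` (its module imports this route file, so no `_holds` link can be stated here).

/-! D-0027 §2.1 — DECIDING THEOREM (planner-authored via `route open/edit --closes-file`; by operator:999:377415 2026-08-15T14:41:35Z):
its hypotheses are this route's items and its conclusion the sub-problem Statement (glue_lint), and it elaborates with this file. -/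

@[closes "route-ValiantsHypothesis-RyserTripartition"] theorem closes : RyserOptimal → TripartitionHard → MultilinearRyserOptimal → ExactDesignsCostly → PerLeTripartition → HostageGlue → RyserToMultilinear → Assembly → _root_.ValiantsHypothesis := fun h_RyserOptimal h_TripartitionHard h_MultilinearRyserOptimal h_ExactDesignsCostly h_PerLeTripartition h_HostageGlue h_RyserToMultilinear h_Assembly => h_Assembly h_RyserOptimal

end Summit.ValiantsHypothesis.ValiantsHypothesis.Theses.RyserTripartition
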